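import Literature.MathematicalPhysics.QuantumLattice.HubbardSquareTorusLimitState
import Literature.MathematicalPhysics.QuantumLattice.HubbardChainTorusLimitState
import HarnessLib

/-!
# Spin densities of thermodynamic-limit states of `S^z = 0` families, and the chain class (I) with spin densities

Topic `MathematicalPhysics/QuantumLattice`. Complement of `HubbardSquareTorusLimitState.lean` (spin densities
`n/2` of the `d = 2` class (I)) and `HubbardChainTorusLimitState.lean` (the chain class (I)):

* `IsTorusLimitOf.expect_nAt_eq_half_density_of_szSector` (any `d`): a torus limit `ω` of unit vectors of
  the sectors `(N_j, S^z = 0)` along sides `L_j → ∞` has spin densities `ω(n_{0↑}) = ω(n_{0↓}) = ρ_ω/2` —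
  with NO hypothesis on the convergence of `N_j / L_j^d` (it converges to `ρ_ω` because the torus averages
  of the density observable do; the spin-`σ` averages are exactly half of them, Lieb 1989 eq. (2));
* `le_hubbardChainEnergyDensityAt_of_forall_torusLimit_spin`: the chain transport
  `le_hubbardChainEnergyDensityAt_of_forall_torusLimit` with the extra by-name hypothesis
  `ω(n_{0σ}) = p/(2q)` available to the bound (the node shape for chain rows whose constant involves the
  spin density, e.g. matrix Pauli–Markov cuts with `C(p/(2q))`).

Everything is PROVED; no definition, no named fact.

## References
* E. H. Lieb, *Two theorems on the Hubbard model*, Phys. Rev. Lett. 62 (1989) 1201, eq. (2) (`S^z = 0`: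
  `N_↑ = N_↓ = N/2`). [cite: LiebPRL1989, eq. (2)]
* D. Ruelle, *Statistical Mechanics: Rigorous Results* (Benjamin 1969), §3.4. [cite: Ruelle1969, §3.4]
-/

noncomputable section

namespace Literature.MathematicalPhysics.QuantumLattice

open Matrix Finset HubbardWave0 _root_.Filter Literature.Probability.LatticeModels ThermodynamicLimit
open scoped _root_.Topology ComplexOrder

variable {d : ℕ}

/-- **Spin densities of a thermodynamic-limit state of `S^z = 0` families are half the particle
density**: if `ω` is a torus limit of unit vectors `ψ (L_j) ∈ (N_j, S^z = 0)` along `L_j → ∞`, then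
`ω(n_{0σ}) = ρ_ω / 2` for both spins. [cite: LiebPRL1989, eq. (2)] -/
theorem InfVolFermionState.IsTorusLimitOf.expect_nAt_eq_half_density_of_szSector {ω : InfVolFermionState d}
    {ψ : ∀ L, Fock (Orb (FermionTorus d L))} {Ls : ℕ → ℕ} (h : ω.IsTorusLimitOf ψ Ls)
    (hLs : Tendsto Ls atTop atTop) {N : ℕ → ℕ} (hS : ∀ j, ψ (Ls j) ∈ szSector (N j) 0)
    (hψ : ∀ j, star (ψ (Ls j)) ⬝ᵥ ψ (Ls j) = 1) (σ : Fin 2) :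
    ω.expect {0} (nAt 0 (Finset.mem_singleton_self 0) σ) = (((ω.density / 2 : ℝ)) : ℂ) := by
  have hN : ∀ j, IsNParticle (N j) (ψ (Ls j)) := fun j => ((mem_szSector_iff _ _ _).1 (hS j)).1
  -- the torus averages of `n_{0↑} + n_{0↓}` converge to `ρ_ω`
  have hdens := h ({0} : Finset (Site d))
    (nAt 0 (Finset.mem_singleton_self 0) 0 + nAt 0 (Finset.mem_singleton_self 0) 1)
  have hval : ω.expect {0} (nAt 0 (Finset.mem_singleton_self 0) 0 + nAt 0 (Finset.mem_singleton_self 0) 1) =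
      ((ω.density : ℝ) : ℂ) := by
    have him : (ω.expect {0} (nAt 0 (Finset.mem_singleton_self 0) 0 +
        nAt 0 (Finset.mem_singleton_self 0) 1)).im = 0 := by
      refine ω.expect_im_eq_zero_of_isHermitian ?_
      rw [nAt, nAt, ← numberAt_orb, ← numberAt_orb]
      exact (numberAt_isHermitian _).add (numberAt_isHermitian _)
    exact Complex.ext (by rw [InfVolFermionState.density, InfVolFermionState.densityAt, Complex.ofReal_re])
      (by rw [him, Complex.ofReal_im])
  rw [hval] at hdens
  -- the spin-`σ` averages are exactly half of them, eventually
  have hlim := h ({0} : Finset (Site d)) (nAt 0 (Finset.mem_singleton_self 0) σ)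
  have heq : ∀ᶠ j in atTop, torusAvgExpect (Ls j) ({0} : Finset (Site d))
      (nAt 0 (Finset.mem_singleton_self 0) σ) (ψ (Ls j)) =
        (1 / 2 : ℂ) * torusAvgExpect (Ls j) ({0} : Finset (Site d))
          (nAt 0 (Finset.mem_singleton_self 0) 0 + nAt 0 (Finset.mem_singleton_self 0) 1) (ψ (Ls j)) := by
    filter_upwards [hLs.eventually_ge_atTop 1] with j hj
    haveI : NeZero (Ls j) := ⟨Nat.one_le_iff_ne_zero.1 hj⟩
    rw [torusAvgExpect_nAt_of_mem_szSector (Ls j) σ (hS j) (hψ j), torusAvgExpect_nAt_add_nAt (Ls j) (hN j) (hψ j)]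
    push_cast
    ring
  have hhalf : Tendsto (fun j => (1 / 2 : ℂ) * torusAvgExpect (Ls j) ({0} : Finset (Site d))
      (nAt 0 (Finset.mem_singleton_self 0) 0 + nAt 0 (Finset.mem_singleton_self 0) 1) (ψ (Ls j))) atTop
      (𝓝 ((1 / 2 : ℂ) * ((ω.density : ℝ) : ℂ))) := hdens.const_mul _
  have hv := tendsto_nhds_unique hlim (hhalf.congr' (heq.mono fun j hj => hj.symm))
  rw [hv]
  push_cast
  ring

/-- **The chain class (I) with spin densities.** If a real number `E` bounds from below the Hubbard
energy density of every translation-invariant, even torus limit `ω` of unit `S^z = 0` sector ground states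
of the rings with density `p/q` AND spin densities `ω(n_{0↑}) = ω(n_{0↓}) = p/(2q)`, then
`E ≤ hubbardChainEnergyDensityAt t U p q` (`U ≥ 0`, `1 ≤ q`, `p ≤ 2q`). [cite: Ruelle1969, §3.4] -/
theorem le_hubbardChainEnergyDensityAt_of_forall_torusLimit_spin (t : ℝ) {U : ℝ} (hU : 0 ≤ U) {p q : ℕ}
    (hq : 1 ≤ q) (hp : p ≤ 2 * q) {E : ℝ}
    (hE : ∀ (ω : InfVolFermionState 1) (ψ : ∀ L, Fock (Orb (FermionTorus 1 L))) (Ls : ℕ → ℕ),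
      Tendsto Ls atTop atTop → ω.IsTorusLimitOf ψ Ls → ω.IsTranslationInvariant → ω.IsEven →
      (∀ j, star (ψ (Ls j)) ⬝ᵥ ψ (Ls j) = 1) →
      (∀ j, ∃ n, IsGroundStateInSector (hubbardTorus 1 (Ls j) t U) (2 * n) 0 (ψ (Ls j))) →
      ω.density = (p : ℝ) / q →
      (∀ σ : Fin 2, ω.expect {0} (nAt 0 (Finset.mem_singleton_self 0) σ) = ((((p : ℝ) / q / 2 : ℝ)) : ℂ)) →
      E ≤ ω.hubbardEnergyDensity t U) :
    E ≤ hubbardChainEnergyDensityAt t U p q := by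
  refine le_hubbardChainEnergyDensityAt_of_forall_torusLimit t hU hq hp fun ω ψ Ls hLs hω hti hev h1 hgs hdens => ?_
  refine hE ω ψ Ls hLs hω hti hev h1 hgs hdens fun σ => ?_
  choose n hn using hgs
  rw [hω.expect_nAt_eq_half_density_of_szSector hLs (fun j => (hn j).1) h1 σ, hdens]

end Literature.MathematicalPhysics.QuantumLattice

end
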